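import Mathlib.Data.Real.Basic
import Mathlib.Tactic.Linarith
import Mathlib.Tactic.Ring
import Mathlib.Tactic.Positivity
import HarnessLib

/-!
# QUANT lane R8, T-DEC, leg (III), blob case — the y-free core inequality (C1′) of arm-2 g36's thin-regime chain for `MixLawCellPDear`
# (hence `MixLawCellA5r`, `MixLawCellA5`): a three-variable real inequality, PROVED under the two side bounds of the plan

builds on p205010 (kernel theorem, internal audit signed; external expert review pending)

Support file (`--supports stmt-CriticalPhenomena-4575`), QUANT lane lead seat prim-quant-lead (gen 33), rung R8 of
`run/shared/lean/prim/quant/LADDER.md`.  Memo: arm-2 g36 `…/prim-quant-arm-2-g36/THIN-REGIME-G36.md` §2/§5; lead g33 NOTES + WAKE-arm-3-g33-A5R.md §4.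
Pure real-arithmetic lemmas (no law, no flow), standard axioms, no sorries.

THE INEQUALITY.  arm-2's chain for the last regime-B P-alone cell is (I_{U₁}) ⟸ (♥) ⟸ (♦) ⟸ C1 ⟸ (C1′) with
  (C1′)  `(1 − g)(1 − 2λ) ≤ (1 − λ)·δ·(g + δ + δ²)`,  `δ = (k₁ + k₂ − t)/(k₂ − k₁) ∈ (0,1]`,
to be fed by two bounds derived from the thin regime: `g ≥ ⅔(1 − δ)` and `δ ≥ 1 − (3/2)λ`.  This file proves (C1′) from exactly those two bounds
(`thinC1'_of_bounds`; lead g33 grid check 69 555 exact points / 0, min ratio 1.58).  On the same grid the weaker `δ ≥ 1 − (7/4)λ` still suffices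
(min ratio 1.34, not typed here) and the rounded `δ ≥ 1 − 2λ` does NOT (3 failures) — so the successor typing the chain has to derive a δ-bound at
least as strong as `1 − (7/4)λ` exactly.  Trivial for `λ ≥ ½` (left side ≤ 0).

* `LawDec.thinC1'_of_bounds`.

[this work]; the chain and the bounds: arm-2 g36.  Nothing here is cited as a published result.
-/

namespace Summit.CriticalPhenomena.PercolationContinuityZ3.Theorems

namespace Quant

namespace LawDec

/-- **(C1′) from `g ≥ ⅔(1−δ)` and `δ ≥ 1 − (3/2)λ`** (`0 ≤ λ ≤ 1`, `0 ≤ δ ≤ 1`, `0 ≤ g ≤ 1`). [this work] -/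
theorem thinC1'_of_bounds (g lam δ : ℝ) (hlam0 : 0 ≤ lam) (hlam1 : lam ≤ 1) (hδ0 : 0 ≤ δ) (hδ1 : δ ≤ 1) (hg0 : 0 ≤ g) (hg1 : g ≤ 1)
    (hg : 2 * (1 - δ) ≤ 3 * g) (hδ : 2 - 3 * lam ≤ 2 * δ) :
    (1 - g) * (1 - 2 * lam) ≤ (1 - lam) * δ * (g + δ + δ ^ 2) := by
  by_cases hl : 1 ≤ 2 * lam
  · have h1 : (1 - g) * (1 - 2 * lam) ≤ 0 := mul_nonpos_of_nonneg_of_nonpos (by linarith) (by linarith)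
    have h2 : 0 ≤ (1 - lam) * δ * (g + δ + δ ^ 2) := by
      have : 0 ≤ 1 - lam := by linarith
      positivity
    linarith
  · have hl : 2 * lam < 1 := not_le.1 hl
    nlinarith [mul_nonneg hδ0 hg0, mul_nonneg hδ0 hδ0, mul_nonneg (mul_nonneg hδ0 hδ0) hδ0, mul_nonneg (sub_nonneg.2 hg) hδ0,
      mul_nonneg (sub_nonneg.2 hδ) hδ0, mul_nonneg (sub_nonneg.2 hδ) (sub_nonneg.2 hg), mul_nonneg (sub_nonneg.2 hg1) hlam0,
      mul_nonneg (sub_nonneg.2 hδ) hlam0, mul_nonneg (mul_nonneg hδ0 hδ0) hlam0, mul_nonneg (sub_nonneg.2 hδ1) hδ0]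

end LawDec

end Quant

end Summit.CriticalPhenomena.PercolationContinuityZ3.Theorems
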